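import Summits.ResolutionOfSingularities.ResolutionOfSingularities.Theorems.FrobeniusLadderFInjectiveMacaulayficationE8Char5FiModel
import Summits.ResolutionOfSingularities.ResolutionOfSingularities.Theorems.FrobeniusLadderFInjectiveMacaulayficationE8Char3NotFiModel
import Summits.ResolutionOfSingularities.ResolutionOfSingularities.Theorems.FrobeniusLadderFInjectiveMacaulayficationE7Forms
import Summits.ResolutionOfSingularities.ResolutionOfSingularities.Theorems.FrobeniusLadderFInjectiveMacaulayficationE7OffCentreRegular
import Summits.ResolutionOfSingularities.ResolutionOfSingularities.Theorems.FrobeniusLadderFInjectiveMacaulayficationE7ChartX0Points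
import Summits.ResolutionOfSingularities.ResolutionOfSingularities.Theorems.FrobeniusLadderFInjectiveMacaulayficationE7ChartX1Points
import Summits.ResolutionOfSingularities.ResolutionOfSingularities.Theorems.FrobeniusLadderFInjectiveMacaulayficationE7ChartX2Unit
import HarnessLib

/-!
# Crux `FInjectiveMacaulayfication`: calibration — the SECOND step of the characteristic-3 tower works: the point
blow-up F-injectivizes the `E₇⁰`-type point `v² + yu³ + y³` in characteristic 3 (line `Sketch`, cycle 6, wave 3)

Support file for crux `stmt-ResolutionOfSingularities-15315` (`FrobeniusLadder.FInjectiveMacaulayfication`, route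
`ResolutionOfSingularities/FrobeniusLadder`, rung 2), line `Sketch`, registered stub `stub_e7Char3FiModel` (lead
assembly of wave 3).

In characteristic 3 the point blow-up of `E₈⁰ = Spec k[X]/(X₂²+X₀³+X₁⁵)` is NOT an F-injective model
(`E8Char3NotFiModel.stub_e8Char3PointBlowupNotFiModel`, p143112): its `y`-chart `R' = k[X]/(g)`,
`g = X₂² + X₁X₀³ + X₁³`, carries an `E₇⁰`-type point at the origin `𝔪'` failing Fedder's test. This file proves that
ONE MORE point blow-up repairs it: `Bl_𝔪'(Spec R') = affineBlowup 𝔪'` is a proper birational model of `Spec R'`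
all of whose stalks satisfy the crux's clause (exponent base 3) — by the E6′ recipe
(`BlowupFiModel.blowupFiModel_of_maximal`): off `𝔪'` the surface is regular (`E7OffCentreRegular`, Jacobian in
char 3: `∂g/∂X₂ = 2X₂`, `∂g/∂X₁ = X₀³`); on the exceptional divisor, the `X₀`-chart `k[X]/(h₀)`,
`h₀ = X₂² + X₁X₀² + X₀X₁³`, has a `D`-type origin PASSING Fedder (`h₀² ∋ 2X₀²X₁X₂²`) and is regular elsewhere
(`E7ChartX0Points`); the `X₁`-chart `k[X]/(h₁)`, `h₁ = X₂² + X₁ + X₀³X₁²`, is regular along `E`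
(`E7ChartX1Points`); the `X₂`-chart misses `E` (`E7ChartX2Unit`); the presentations are `E7Forms.stub_e7Forms` with
`StrictTransformChart`. Together with p139106 (char 5: one step) and the compute survey
`Cruxes/FInjectiveMacaulayfication/SURVEY-fpurify-point-blowups.md` (char 3: `E₈⁰` needs exactly two steps; char 2:
four of the five resolution steps) this completes the calibration of the naive point-blow-up engine on `E₈⁰`.

* `chart_clause_of_presentation` — `E8Char5FiModel.chart_clause_of_presentation` for a general exponent base `p` (with
  `E7ChartX0Points`/`E7ChartX1Points` it gives the chart certificates a non-affine glue through `FiModelOfCharts` needs);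
* `e7Char3FiModel`, `stub_e7Char3FiModel` — the model;
* `e7Char3_origin_not_clause` — the input is not its own model (the clause fails at `𝔪'`, p141939).

References: R. Fedder, Trans. AMS 278 (1983), Prop. 1.7, Thm. 1.12; The Stacks Project, Tag 0804. [folklore]
-/

-- single-problem summit: the doubled namespace component is forced
set_option linter.dupNamespace false

noncomputable section

namespace Summit.ResolutionOfSingularities.ResolutionOfSingularities.Theorems.FInjectiveMacaulayfication.E7Char3FiModel

open AlgebraicGeometry CategoryTheory Literature.AlgebraicGeometry.Resolution
open Summit.ResolutionOfSingularities.ResolutionOfSingularities.Theorems.FInjectiveMacaulayfication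

-- budget: the chart-ring types make every unification step on this statement expensive (≈ 3× default)
set_option maxHeartbeats 800000 in
/-- The chart dictionary for a VARIABLE chart index `i` and exponent base `p`
(`E8Char5FiModel.chart_clause_of_presentation`, which is the case `p = 5`): a strict-transform presentation
`k[X]/(g) ≅ A_i = (R[𝔪t])_{(x̄ᵢt)}` (`StrictTransformChart.stub_strictTransformChart`) carries "the clause at the
maximal ideals of `k[X]/(g)` containing `X̄ᵢ`" to "the clause at the maximal ideals of `A_i` containing `x̄ᵢ/1`"
(`E8Char5FiModel.clause_maximal_of_ringEquiv`). [folklore] -/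
theorem chart_clause_of_presentation (p : ℕ) (k : Type) [Field k] (f : MvPolynomial (Fin 3) k)
    (hfprime : (Ideal.span {f}).IsPrime) (hf0 : f ≠ 0)
    (x : Fin 3 → MvPolynomial (Fin 3) k ⧸ Ideal.span {f})
    (hx : x = fun j : Fin 3 => Ideal.Quotient.mk (Ideal.span {f}) (MvPolynomial.X j))
    (i : Fin 3) (g : MvPolynomial (Fin 3) k) (μ : ℕ) (hg : (Ideal.span {g}).IsPrime)
    (hXg : MvPolynomial.X i ∉ Ideal.span {g})
    (hθ : MvPolynomial.aeval (fun j : Fin 3 => if j = i then (MvPolynomial.X i : MvPolynomial (Fin 3) k)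
        else MvPolynomial.X j * MvPolynomial.X i) f = MvPolynomial.X i ^ μ * g)
    (hpts : ∀ (Q' : Ideal (MvPolynomial (Fin 3) k ⧸ Ideal.span {g})) [Q'.IsMaximal],
        Ideal.Quotient.mk (Ideal.span {g}) (MvPolynomial.X i) ∈ Q' →
        ∀ d : ℕ, ringKrullDim (Localization.AtPrime Q') = d → ∀ s : Fin d → Localization.AtPrime Q',
          (Ideal.span (Set.range s)).radical.IsMaximal →
            RingTheory.Sequence.IsWeaklyRegular (Localization.AtPrime Q') (List.ofFn s) ∧
            ∀ y : Localization.AtPrime Q', (∃ e : ℕ, y ^ p ^ e ∈ Ideal.span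
              ((fun z : Localization.AtPrime Q' => z ^ p ^ e) ''
                (Ideal.span (Set.range s) : Set (Localization.AtPrime Q')))) → y ∈ Ideal.span (Set.range s))
    (Q : Ideal (HomogeneousLocalization.Away (reesGrading (Ideal.span (Set.range x)))
          (reesT (x i) (Ideal.subset_span (Set.mem_range_self i))))) [Q.IsMaximal]
    (huQ : reesChartBase (x i) (Ideal.subset_span (Set.mem_range_self i)) (x i) ∈ Q) :
    ∀ d : ℕ, ringKrullDim (Localization.AtPrime Q) = d → ∀ s : Fin d → Localization.AtPrime Q,
      (Ideal.span (Set.range s)).radical.IsMaximal →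
        RingTheory.Sequence.IsWeaklyRegular (Localization.AtPrime Q) (List.ofFn s) ∧
        ∀ y : Localization.AtPrime Q, (∃ e : ℕ, y ^ p ^ e ∈ Ideal.span
          ((fun z : Localization.AtPrime Q => z ^ p ^ e) ''
            (Ideal.span (Set.range s) : Set (Localization.AtPrime Q)))) → y ∈ Ideal.span (Set.range s) := by
  obtain ⟨e, he⟩ := StrictTransformChart.stub_strictTransformChart k f g i μ hfprime hf0 hg hXg hθ x hx
  -- (elaborate the transported clause WITHOUT the goal as expected type, then close by `exact`)
  have key := E8Char5FiModel.clause_maximal_of_ringEquiv p e _ _ he (fun Q' _ hQ' => hpts Q' hQ') Q huQ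
  exact key

/-- Off the origin the `E₇⁰`-type surface `k[X]/(X₂²+X₁X₀³+X₁³)` (characteristic `3`) is regular, hence its local
rings satisfy the full stalk clause (`E7OffCentreRegular.stub_e7OffCentreRegular`, `FiClauseOfRegular`). [folklore] -/
theorem offCentre_fiClause (k : Type) [Field k] [CharP k 3] (g : MvPolynomial (Fin 3) k)
    (hg : g = MvPolynomial.X 2 ^ 2 + MvPolynomial.X 1 * MvPolynomial.X 0 ^ 3 + MvPolynomial.X 1 ^ 3)
    (P : Ideal (MvPolynomial (Fin 3) k ⧸ Ideal.span {g})) [P.IsPrime]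
    (hP : ¬ Ideal.span (Set.range fun j : Fin 3 => Ideal.Quotient.mk (Ideal.span {g}) (MvPolynomial.X j)) ≤ P) :
    IsDomain (Localization.AtPrime P) ∧
      ∀ d : ℕ, ringKrullDim (Localization.AtPrime P) = d → ∀ s : Fin d → Localization.AtPrime P,
        (Ideal.span (Set.range s)).radical.IsMaximal →
          RingTheory.Sequence.IsWeaklyRegular (Localization.AtPrime P) (List.ofFn s) ∧
          ∀ y : Localization.AtPrime P, (∃ e : ℕ, y ^ 3 ^ e ∈ Ideal.span
            ((fun z : Localization.AtPrime P => z ^ 3 ^ e) ''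
              (Ideal.span (Set.range s) : Set (Localization.AtPrime P)))) → y ∈ Ideal.span (Set.range s) := by
  haveI : Fact (Nat.Prime 3) := ⟨Nat.prime_three⟩
  haveI : IsRegularLocalRing (Localization.AtPrime P) := E7OffCentreRegular.stub_e7OffCentreRegular k g hg P hP
  haveI : CharP (Localization.AtPrime P) 3 :=
    CharP.of_ringHom_of_ne_zero (algebraMap k (Localization.AtPrime P)) 3 (by decide)
  exact FiClauseOfRegular.stub_fiClauseOfRegular 3 (Localization.AtPrime P)

/-- **The point blow-up F-injectivizes the `E₇⁰`-type point in characteristic 3** (second step of the char-3 tower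
for `E₈⁰`): for every field `k` of characteristic `3` and `g = X₂² + X₁X₀³ + X₁³`, the blow-up of `Spec k[X]/(g)` at
the origin is a proper birational model all of whose stalks are domains with every system of parameters weakly
regular and every parameter ideal Frobenius closed. [folklore] -/
theorem e7Char3FiModel (k : Type) [Field k] [CharP k 3] (g : MvPolynomial (Fin 3) k)
    (hg : g = MvPolynomial.X 2 ^ 2 + MvPolynomial.X 1 * MvPolynomial.X 0 ^ 3 + MvPolynomial.X 1 ^ 3) :
    ∃ (X' : Scheme.{0}) (π : X' ⟶ Spec (.of (MvPolynomial (Fin 3) k ⧸ Ideal.span {g}))), IsProper π ∧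
      Literature.AlgebraicGeometry.Resolution.IsBirational π ∧
      ∀ y : X', IsDomain (X'.presheaf.stalk y) ∧ ∀ d : ℕ, ringKrullDim (X'.presheaf.stalk y) = d →
        ∀ s : Fin d → X'.presheaf.stalk y, (Ideal.span (Set.range s)).radical.IsMaximal →
          RingTheory.Sequence.IsWeaklyRegular (X'.presheaf.stalk y) (List.ofFn s) ∧
          ∀ z : X'.presheaf.stalk y, (∃ e : ℕ, z ^ 3 ^ e ∈
              Ideal.span ((fun w : X'.presheaf.stalk y => w ^ 3 ^ e) ''
                (Ideal.span (Set.range s) : Set (X'.presheaf.stalk y)))) →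
            z ∈ Ideal.span (Set.range s) := by
  haveI : Fact (Nat.Prime 3) := ⟨Nat.prime_three⟩
  -- the forms: `g` prime and non-zero, the strict transforms `h0`, `h1` prime, the chart identities
  obtain ⟨h0, hh0⟩ : ∃ h0 : MvPolynomial (Fin 3) k,
      h0 = MvPolynomial.X 2 ^ 2 + MvPolynomial.X 1 * MvPolynomial.X 0 ^ 2 + MvPolynomial.X 0 * MvPolynomial.X 1 ^ 3 :=
    ⟨_, rfl⟩
  obtain ⟨h1, hh1⟩ : ∃ h1 : MvPolynomial (Fin 3) k,
      h1 = MvPolynomial.X 2 ^ 2 + MvPolynomial.X 1 + MvPolynomial.X 0 ^ 3 * MvPolynomial.X 1 ^ 2 := ⟨_, rfl⟩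
  obtain ⟨⟨hgprime, hg0⟩, ⟨hh0prime, hX0h0, hθ0⟩, ⟨hh1prime, hX1h1, hθ1⟩⟩ := E7Forms.stub_e7Forms k g h0 h1 hg hh0 hh1
  -- `X₁ ∉ (g)` from the first-step forms (`g` is their `g_y`)
  obtain ⟨-, -, -, hX1g, -⟩ := E8Forms.stub_e8Forms k (MvPolynomial.X 2 ^ 2 + MvPolynomial.X 0 ^ 3 + MvPolynomial.X 1 ^ 5)
    (MvPolynomial.X 2 ^ 2 + MvPolynomial.X 0 + MvPolynomial.X 0 ^ 3 * MvPolynomial.X 1 ^ 5) g rfl rfl hg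
  haveI := hgprime
  -- `R' = k[X]/(g)` is a Noetherian domain of characteristic 3
  haveI : IsDomain (MvPolynomial (Fin 3) k ⧸ Ideal.span {g}) := Ideal.Quotient.isDomain _
  haveI : CharP (MvPolynomial (Fin 3) k ⧸ Ideal.span {g}) 3 :=
    CharP.of_ringHom_of_ne_zero (algebraMap k (MvPolynomial (Fin 3) k ⧸ Ideal.span {g})) 3 (by decide)
  -- the centre: `𝔪' = (x̄₀, x̄₁, x̄₂) ≠ 0`
  obtain ⟨x, hx⟩ : ∃ x : Fin 3 → MvPolynomial (Fin 3) k ⧸ Ideal.span {g},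
      x = fun j : Fin 3 => Ideal.Quotient.mk (Ideal.span {g}) (MvPolynomial.X j) := ⟨_, rfl⟩
  have hI : Ideal.span (Set.range x) ≠ ⊥ := by
    intro hbot
    have hx1 : x 1 ∈ Ideal.span (Set.range x) := Ideal.subset_span (Set.mem_range_self 1)
    rw [hbot, Ideal.mem_bot, hx] at hx1
    exact hX1g (Ideal.Quotient.eq_zero_iff_mem.mp hx1)
  refine BlowupFiModel.blowupFiModel_of_maximal 3 x hI ?_ ?_
  · -- off the origin `R'_P` is regular, hence satisfies the clause
    intro P _ hP
    have hP' : ¬ Ideal.span (Set.range fun j : Fin 3 =>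
        Ideal.Quotient.mk (Ideal.span {g}) (MvPolynomial.X j)) ≤ P := by rwa [← hx]
    exact offCentre_fiClause k g hg P hP'
  · -- on the exceptional divisor, chart by chart
    intro i _ Q hQ huQ
    have hi : i = 0 ∨ i = 1 ∨ i = 2 := by
      fin_cases i <;> simp
    rcases hi with rfl | rfl | rfl
    · -- the `X₀`-chart `k[X]/(h0)`: the `D`-type origin passes Fedder, the other exceptional closed points are regular
      have key := chart_clause_of_presentation 3 k g hgprime hg0 x hx 0 h0 2 hh0prime hX0h0 hθ0
        (fun Q' _ hQ' => E7ChartX0Points.stub_e7ChartX0Points k h0 hh0 Q' hQ') Q huQ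
      exact key
    · -- the `X₁`-chart `k[X]/(h1)`: regular along the exceptional divisor
      have key := chart_clause_of_presentation 3 k g hgprime hg0 x hx 1 h1 2 hh1prime hX1h1 hθ1
        (fun Q' _ hQ' => E7ChartX1Points.stub_e7ChartX1Points k h1 hh1 Q' hQ') Q huQ
      exact key
    · -- the `X₂`-chart misses the exceptional divisor: `x̄₂/1` is a unit
      have hunit := E7ChartX2Unit.stub_e7ChartX2Unit k g hg x hx
      exact absurd (Ideal.eq_top_of_isUnit_mem Q huQ hunit) hQ.ne_top

/-- **The input is NOT its own model**: in characteristic `3` the `E₇⁰`-type surface `k[X]/(X₂²+X₁X₀³+X₁³)` violates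
the clause at its local ring at the origin (`E8Char3NotFiModel.gy_quotient_origin_not_clause`, Fedder) — so
`e7Char3FiModel` is a genuine repair of a non-F-injective Cohen–Macaulay point by a non-parameter centre.
[cite: Fedder1983, Thm. 1.12] -/
theorem e7Char3_origin_not_clause (k : Type) [Field k] [CharP k 3] (g : MvPolynomial (Fin 3) k)
    (hg : g = MvPolynomial.X 2 ^ 2 + MvPolynomial.X 1 * MvPolynomial.X 0 ^ 3 + MvPolynomial.X 1 ^ 3) :
    ∃ (P : Ideal (MvPolynomial (Fin 3) k ⧸ Ideal.span {g})) (_ : P.IsMaximal),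
      ¬ (∀ d : ℕ, ringKrullDim (Localization.AtPrime P) = d → ∀ s : Fin d → Localization.AtPrime P,
        (Ideal.span (Set.range s)).radical.IsMaximal →
          RingTheory.Sequence.IsWeaklyRegular (Localization.AtPrime P) (List.ofFn s) ∧
          ∀ y : Localization.AtPrime P, (∃ e : ℕ, y ^ 3 ^ e ∈ Ideal.span
            ((fun z : Localization.AtPrime P => z ^ 3 ^ e) ''
              (Ideal.span (Set.range s) : Set (Localization.AtPrime P)))) → y ∈ Ideal.span (Set.range s)) := by
  subst hg
  haveI hmax : (Ideal.span (Set.range (MvPolynomial.X : Fin 3 → MvPolynomial (Fin 3) k))).IsMaximal :=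
    Fedder.isMaximal_span_range_X k 3
  have hgm : (MvPolynomial.X 2 ^ 2 + MvPolynomial.X 1 * MvPolynomial.X 0 ^ 3 + MvPolynomial.X 1 ^ 3 :
      MvPolynomial (Fin 3) k) ∈ Ideal.span (Set.range (MvPolynomial.X : Fin 3 → MvPolynomial (Fin 3) k)) :=
    (E8ChartYPoints.gy_mem_and_ne_zero k).1
  have hker : RingHom.ker (Ideal.Quotient.mk (Ideal.span {(MvPolynomial.X 2 ^ 2 +
      MvPolynomial.X 1 * MvPolynomial.X 0 ^ 3 + MvPolynomial.X 1 ^ 3 : MvPolynomial (Fin 3) k)})) ≤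
      Ideal.span (Set.range (MvPolynomial.X : Fin 3 → MvPolynomial (Fin 3) k)) := by
    rw [Ideal.mk_ker, Ideal.span_singleton_le_iff_mem]
    exact hgm
  obtain ⟨hPmax, hcomap⟩ := BlowupFiModel.isMaximal_map_and_comap_map_of_surjective
    (Ideal.Quotient.mk (Ideal.span {(MvPolynomial.X 2 ^ 2 + MvPolynomial.X 1 * MvPolynomial.X 0 ^ 3 +
      MvPolynomial.X 1 ^ 3 : MvPolynomial (Fin 3) k)})) Ideal.Quotient.mk_surjective
    (Ideal.span (Set.range (MvPolynomial.X : Fin 3 → MvPolynomial (Fin 3) k))) hker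
  haveI := hPmax
  exact ⟨_, hPmax, E8Char3NotFiModel.gy_quotient_origin_not_clause k _ rfl _ hcomap⟩

/-- **CALIBRATION, registered form** (lead stub `stub_e7Char3FiModel` of crux stmt-ResolutionOfSingularities-15315,
line `Sketch`): the point blow-up F-injectivizes the `E₇⁰`-type point `X₂² + X₁X₀³ + X₁³` in characteristic `3` —
`= e7Char3FiModel`. [folklore] -/
theorem stub_e7Char3FiModel : ∀ (k : Type) [Field k] [CharP k 3] (g : MvPolynomial (Fin 3) k),
    g = MvPolynomial.X 2 ^ 2 + MvPolynomial.X 1 * MvPolynomial.X 0 ^ 3 + MvPolynomial.X 1 ^ 3 →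
    ∃ (X' : Scheme.{0}) (π : X' ⟶ Spec (.of (MvPolynomial (Fin 3) k ⧸ Ideal.span {g}))), IsProper π ∧
      Literature.AlgebraicGeometry.Resolution.IsBirational π ∧
      ∀ y : X', IsDomain (X'.presheaf.stalk y) ∧ ∀ d : ℕ, ringKrullDim (X'.presheaf.stalk y) = d →
        ∀ s : Fin d → X'.presheaf.stalk y, (Ideal.span (Set.range s)).radical.IsMaximal →
          RingTheory.Sequence.IsWeaklyRegular (X'.presheaf.stalk y) (List.ofFn s) ∧
          ∀ z : X'.presheaf.stalk y, (∃ e : ℕ, z ^ 3 ^ e ∈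
              Ideal.span ((fun w : X'.presheaf.stalk y => w ^ 3 ^ e) ''
                (Ideal.span (Set.range s) : Set (X'.presheaf.stalk y)))) →
            z ∈ Ideal.span (Set.range s) :=
  fun k _ _ g hg => e7Char3FiModel k g hg

end Summit.ResolutionOfSingularities.ResolutionOfSingularities.Theorems.FInjectiveMacaulayfication.E7Char3FiModel

end
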